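import Summits.Schanuel.Schanuel.Theorems.RootDecomp1KHyper69

/-!
# RootDecomp1KHyper — lens 6, generation 17 «BILOG STAIRCASE CELL» (BilogStair.lean edition 6 9dc464df…, 4886 l; §P `conjDataII_holds`, `transferII_holds`) — continuation (RootDecomp1KHyper70): §P (i) the power identity, the envelope polynomial `envPoly`, α-data and denominators

(lens-6 g17 `BilogStair.lean` EDITION 6, sha256 9dc464df…9ee3, 4886 l, own farm rc 0 · 0 warn · 0 sorry · axioms std; §A–§O = editions 2–5 (ported as
`RootDecomp1KHyper53`–`69`), §P appended in edition 6 (NODE/EDITION6 L1806 / REQUEST L1807: statement diff 0 removed / 0 changed / 42 added — THEOREM-credit claim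
for `transferII_holds : TransferII` under L1724 Q3 / L1789; writer re-check L1811; critic VERDICT L1812: ONE THEOREM credit to lens-6 g17 for `transferII_holds`, PORT GO); port by census-1 gen 16 in parts `RootDecomp1KHyper70`–`71` at the
lens's cut — 70 = §P power identity `gam_pow_eq`, envelope relation `envG` / `univ0` / `envPoly` (zeros ↔ x^N = α_j^M; kills γ_k and its ℚ-conjugates; ≠ 0; degree and
root bounds), α-data `exists_intPoly`, `exists_house_const`, denominators `isIntegral_lc_mul` / `isIntegral_tc_mul_inv` / `isIntegral_denom_mul`; 71 = the conjugate polynomial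
`conjPoly D γ = (minpoly ℤ (Dγ))(D·T)` (≠ 0, kills γ, roots = IsConjRoot ℚ γ, degree ≤ any integer killer, coefficient bounds), `conjData_pointwise`, `conjDataII_holds : ConjDataII`,
`innerNormII_holds`, `transferII_holds : TransferII` (TRANSFER II AS TYPED SINCE ED.1 IS A THEOREM, hypothesis-free), `sb_three_zB_of_transferI (hI : TransferI) : SB 3 zB`.
PORT edits: `pow_eq_exp_log` / `isIntegral_intCast'` / `coeff_comp_C_mul_X` private (per-part copies); sixteen one-line docstrings added; statements and proofs otherwise verbatim.
`--supports stmt-Schanuel-33363`; no census credit carried by the port (TransferI and the member package Q1/Q2 remain open for the THIRD⁗ cell credit); rung 0.)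
-/

open Complex Polynomial IntermediateField Filter
open scoped BigOperators

namespace Summit.Schanuel.Schanuel.Theorems.RootDecomp1KHyper

namespace HyperCell

namespace LatCell

namespace Bilog

variable {n : ℕ}
open Summit.Schanuel.Schanuel.Theorems.RootDecomp1KRelLiouvilleCell (mvPolyMeasure_one_of_polyMeasure ycoeff
  mvaeval_cons_eq_sum mvlen_ycoeff_le natDegree_finSuccEquiv_le_totalDegree norm_mvaeval_le_mvlen_mul_pow)

section ConjDataDev

/-- Roots of the complexified integer polynomial are its complex zeros. -/
private theorem mem_roots_map_iff {f : ℤ[X]} (hf : f ≠ 0) (z : ℂ) :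
    z ∈ (f.map (Int.castRingHom ℂ)).roots ↔ Polynomial.aeval z f = 0 := by
  rw [Polynomial.mem_roots ((Polynomial.map_ne_zero_iff (Int.castRingHom ℂ).injective_int).mpr hf),
    Polynomial.IsRoot.def, Polynomial.eval_map, Polynomial.aeval_def, algebraMap_int_eq]

/-! ## §P  (EDITION 6) `ConjDataII` PROVED — hence `InnerNormII` and `TransferII` unconditionally

Ingredients: the power identity `γ_k^{N_k} = α^{M_k}` (`N_k = 2 den a_k den b_k`, `M_k = 2 den a_k num b_k`, both
`≤ 2H_k²` in size); α-data (`P ∈ ℤ[T]`, `P ≠ 0`, `P(α) = 0`, no root at `0`; a house constant `A ≥ 1` bounding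
`‖α_j‖` and `‖α_j‖⁻¹`); the ENVELOPE polynomial `envPoly P N M ∈ ℤ[T]` = `Res_T(P(T), x₁^N − T^M)` (resp.
`x₁^N T^{|M|} − 1`) specialised at `x₁ := T', x₂ := 0`: it vanishes exactly at the `x` with `x^N = α_j^M`, so it
kills `γ_k` and every `ℚ`-conjugate of `γ_k`, has degree `≤ (deg P + N + |M|)(N + |M|)`, and its roots have modulus
`≤ A^{|M|}`; the DENOMINATOR `D = (lc P · tc P)^{|M|}` makes `D·x` an algebraic integer for every root `x` (via `P`
and its reverse polynomial); the CONJUGATE POLYNOMIAL `conjPoly D γ := (minpoly ℤ (Dγ))(D·T)`: non-zero, kills `γ`,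
roots = the `ℚ`-conjugates of `γ` (`ℤ` integrally closed + irreducibility + rational rescaling), degree `≤` that of
any non-zero integer polynomial killing `γ`, `|coeff_i| ≤ |D|^i B^d C(d,i)` (`coeff_le_of_roots_le`, `B` a bound for
the conjugates of `Dγ`). ONE exponent `c = deg P + 12 + K` (`K ≥ 2 log A + 4 log|lc P·tc P| + 1`, independent of
`k`) serves all three eventual bounds of `ConjDataII` — in fact they hold for EVERY `k`. CAVEAT (recorded in ed.5,
kept): the envelope itself may have roots that are NOT `ℚ`-conjugates of `γ_k` (`α = 4`, `γ = 2`: root `−2` of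
`T² − 4`), which is why `f_k` is the rescaled MINIMAL polynomial `conjPoly` and the envelope only supplies the
degree, house and denominator estimates. -/

/-- Clearing denominators: `(2 den a_k den b_k) · a_k = 2 den b_k · num a_k`. -/
theorem natMul_ratA (a b : ℕ → ℚ) (k : ℕ) :
    ((2 * (a k).den * (b k).den : ℕ) : ℚ) * a k = 2 * (b k).den * (a k).num := by
  push_cast
  have := Rat.mul_den_eq_num (a k)
  linear_combination (2 * ((b k).den : ℚ)) * this

/-- Clearing denominators: `(2 den a_k den b_k) · b_k = 2 den a_k · num b_k`. -/
theorem natMul_ratB (a b : ℕ → ℚ) (k : ℕ) :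
    ((2 * (a k).den * (b k).den : ℕ) : ℚ) * b k = 2 * (a k).den * (b k).num := by
  push_cast
  have := Rat.mul_den_eq_num (b k)
  linear_combination (2 * ((a k).den : ℚ)) * this

/-- The power identity `γ_k^{2 den a_k den b_k} = α^{2 den a_k num b_k}` (`α = e^{iℓ}`). -/
theorem gam_pow_eq (ℓ : ℝ) (a b : ℕ → ℚ) (k : ℕ) :
    gam ℓ a b k ^ (2 * (a k).den * (b k).den) =
      cexp ((ℓ : ℂ) * I) ^ (2 * ((a k).den : ℤ) * (b k).num) := by
  unfold gam
  rw [← Complex.exp_nat_mul, ← Complex.exp_int_mul]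
  have hna' : (((2 * (a k).den * (b k).den : ℕ) : ℂ)) * (a k : ℂ) = 2 * (b k).den * (a k).num := by
    exact_mod_cast natMul_ratA a b k
  have hnb' : (((2 * (a k).den * (b k).den : ℕ) : ℂ)) * (b k : ℂ) = 2 * (a k).den * (b k).num := by
    exact_mod_cast natMul_ratB a b k
  have h1 : ((2 * (a k).den * (b k).den : ℕ) : ℂ) * ((((a k : ℝ) * Real.pi + (b k : ℝ) * ℓ : ℝ) : ℂ) * I) =
      (((b k).den * (a k).num : ℤ) : ℂ) * (2 * Real.pi * I) +
        ((2 * ((a k).den : ℤ) * (b k).num : ℤ) : ℂ) * ((ℓ : ℂ) * I) := by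
    push_cast at hna' hnb' ⊢
    linear_combination ((Real.pi : ℂ) * I) * hna' + ((ℓ : ℂ) * I) * hnb'
  rw [h1, Complex.exp_add, Complex.exp_int_mul_two_pi_mul_I, one_mul]

/-- The exponents are `≤ 2 H_k²` in absolute value. -/
theorem two_den_den_le (a b : ℕ → ℚ) (k : ℕ) :
    ((2 * (a k).den * (b k).den : ℕ) : ℝ) ≤ 2 * hgt a b k ^ 2 := by
  have h := den_mul_den_le_hgt_sq a b k
  push_cast at h ⊢
  linarith

/-- `|2 den a_k num b_k| ≤ 2 H_k²`. -/
theorem two_den_num_le (a b : ℕ → ℚ) (k : ℕ) :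
    |((2 * ((a k).den : ℤ) * (b k).num : ℤ) : ℝ)| ≤ 2 * hgt a b k ^ 2 := by
  have h := (num_mul_den_le_hgt_sq a b k).2
  push_cast at h ⊢
  rw [show (2 : ℝ) * ((a k).den : ℝ) * ((b k).num : ℝ) = 2 * (((b k).num : ℝ) * ((a k).den : ℝ)) by ring, abs_mul,
    abs_of_pos (by norm_num : (0 : ℝ) < 2)]
  linarith

/-- The envelope relation `x₁^N − T^m` (for `M = m ≥ 0`) resp. `x₁^N T^m − 1` (for `M = −m < 0`), in `ℤ[x₁, x₂, T]`. -/
noncomputable def envG (N : ℕ) (M : ℤ) : MvPolynomial (Fin 3) ℤ :=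
  if 0 ≤ M then MvPolynomial.X 0 ^ N - MvPolynomial.X 2 ^ M.toNat
  else MvPolynomial.X 0 ^ N * MvPolynomial.X 2 ^ (-M).toNat - 1

/-- The envelope relation `envG N M` vanishes at `(x, y, t)` iff `x^N = t^M` (`t ≠ 0`). -/
theorem aeval_envG_eq_zero_iff (N : ℕ) (M : ℤ) (x y t : ℂ) (ht : t ≠ 0) :
    MvPolynomial.aeval ![x, y, t] (envG N M) = 0 ↔ x ^ N = t ^ M := by
  unfold envG
  split_ifs with hM
  · simp only [map_sub, map_pow, MvPolynomial.aeval_X, Matrix.cons_val_zero, Matrix.cons_val_two,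
      Matrix.tail_cons, Matrix.head_cons, sub_eq_zero]
    rw [show t ^ M = t ^ M.toNat by rw [← zpow_natCast, Int.toNat_of_nonneg hM]]
  · push Not at hM
    simp only [map_sub, map_mul, map_pow, map_one, MvPolynomial.aeval_X, Matrix.cons_val_zero,
      Matrix.cons_val_two, Matrix.tail_cons, Matrix.head_cons, sub_eq_zero]
    have htm : t ^ (-M).toNat ≠ 0 := pow_ne_zero _ ht
    rw [show t ^ M = (t ^ (-M).toNat)⁻¹ by
      rw [← zpow_natCast, Int.toNat_of_nonneg (by omega : 0 ≤ -M), zpow_neg, inv_inv]]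
    constructor
    · intro h; exact eq_inv_of_mul_eq_one_left h
    · intro h; rw [h, inv_mul_cancel₀ htm]

/-- `tdeg (envG N M) ≤ N + |M|`. -/
theorem totalDegree_envG_le (N : ℕ) (M : ℤ) : (envG N M).totalDegree ≤ N + M.natAbs := by
  unfold envG
  split_ifs with hM
  · refine (MvPolynomial.totalDegree_sub _ _).trans (max_le ?_ ?_)
    · exact (MvPolynomial.totalDegree_pow _ _).trans (by rw [MvPolynomial.totalDegree_X]; omega)
    · refine (MvPolynomial.totalDegree_pow _ _).trans ?_
      rw [MvPolynomial.totalDegree_X]; omega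
  · refine (MvPolynomial.totalDegree_sub _ _).trans (max_le ?_ (by simp))
    refine (MvPolynomial.totalDegree_mul _ _).trans (add_le_add ?_ ?_)
    · exact (MvPolynomial.totalDegree_pow _ _).trans (by rw [MvPolynomial.totalDegree_X]; omega)
    · refine (MvPolynomial.totalDegree_pow _ _).trans ?_
      rw [MvPolynomial.totalDegree_X]; omega

/-- The univariate specialisation `x₂ := 0`, `x₁ := T` of a polynomial in `ℤ[x₁, x₂]`. -/
noncomputable def univ0 (Q : MvPolynomial (Fin 2) ℤ) : ℤ[X] :=
  MvPolynomial.aeval ![(Polynomial.X : ℤ[X]), 0] Q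

/-- Evaluating `univ0 Q` at `x` is evaluating `Q` at `(x, 0)`. -/
theorem aeval_univ0 {A : Type*} [CommRing A] (Q : MvPolynomial (Fin 2) ℤ) (x : A) :
    Polynomial.aeval x (univ0 Q) = MvPolynomial.aeval ![x, 0] Q := by
  unfold univ0
  have h := DFunLike.congr_fun (MvPolynomial.comp_aeval (R := ℤ)
    (Polynomial.aeval x : ℤ[X] →ₐ[ℤ] A) (f := ![(Polynomial.X : ℤ[X]), 0])) Q
  have hfun : (fun i => (Polynomial.aeval x : ℤ[X] →ₐ[ℤ] A) (![(Polynomial.X : ℤ[X]), 0] i)) = ![x, 0] := by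
    funext i
    match i with
    | 0 => simp
    | 1 => simp
  rw [hfun] at h
  exact h

/-- `deg (univ0 Q) ≤ tdeg Q`. -/
theorem natDegree_univ0_le (Q : MvPolynomial (Fin 2) ℤ) : (univ0 Q).natDegree ≤ Q.totalDegree := by
  classical
  unfold univ0
  conv_lhs => rw [MvPolynomial.as_sum Q]
  rw [map_sum]
  refine Polynomial.natDegree_sum_le_of_forall_le _ _ fun s hs => ?_
  rw [MvPolynomial.aeval_monomial, Finsupp.prod_pow, Fin.prod_univ_two]
  simp only [Matrix.cons_val_zero, Matrix.cons_val_one, eq_intCast]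
  refine natDegree_mul_le.trans ?_
  rw [natDegree_intCast, zero_add]
  refine natDegree_mul_le.trans ?_
  rw [natDegree_X_pow]
  refine (Nat.add_le_add_left (Polynomial.natDegree_pow_le (p := (0 : ℤ[X])) (n := s 1)) (s 0)).trans ?_
  rw [Polynomial.natDegree_zero, mul_zero, add_zero]
  calc s 0 ≤ s.sum fun _ e => e := by
        by_cases h0 : (0 : Fin 2) ∈ s.support
        · exact Finset.single_le_sum (fun _ _ => Nat.zero_le _) h0
        · rw [Finsupp.notMem_support_iff.mp h0]; exact Nat.zero_le _
    _ ≤ Q.totalDegree := MvPolynomial.le_totalDegree hs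

/-- The ENVELOPE polynomial of `γ_k`: `envPoly P N M := Res_T(P(T), x₁^N − T^M)|_{x₁ := T', x₂ := 0} ∈ ℤ[T']`. -/
noncomputable def envPoly (P : ℤ[X]) (N : ℕ) (M : ℤ) : ℤ[X] := univ0 (resT P (envG N M))

/-- Product formula: `envPoly(x) = lc^n ∏_{P(α_j)=0} envG(x, 0, α_j)`. -/
theorem aeval_envPoly (P : ℤ[X]) (N : ℕ) (M : ℤ) (x : ℂ) :
    Polynomial.aeval x (envPoly P N M) =
      (P.map (Int.castRingHom ℂ)).leadingCoeff ^ (toPolyT (envG N M)).natDegree *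
        ((P.map (Int.castRingHom ℂ)).roots.map fun z => MvPolynomial.aeval ![x, 0, z] (envG N M)).prod := by
  unfold envPoly
  rw [aeval_univ0, aeval_resT]

/-- Zeros of the envelope: `envPoly(x) = 0 ↔ x^N = α_j^M` for some root `α_j` of `P` (all roots non-zero). -/
theorem aeval_envPoly_eq_zero_iff {P : ℤ[X]} (hP : P ≠ 0) (h0 : ∀ z : ℂ, Polynomial.aeval z P = 0 → z ≠ 0)
    (N : ℕ) (M : ℤ) (x : ℂ) :
    Polynomial.aeval x (envPoly P N M) = 0 ↔ ∃ z : ℂ, Polynomial.aeval z P = 0 ∧ x ^ N = z ^ M := by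
  classical
  have hP' : P.map (Int.castRingHom ℂ) ≠ 0 := fun h =>
    hP (Polynomial.map_injective (Int.castRingHom ℂ) Int.cast_injective (by rw [h, Polynomial.map_zero]))
  have hlc : (P.map (Int.castRingHom ℂ)).leadingCoeff ≠ 0 := fun h => hP' (Polynomial.leadingCoeff_eq_zero.mp h)
  rw [aeval_envPoly, mul_eq_zero, or_iff_right (pow_ne_zero _ hlc), Multiset.prod_eq_zero_iff, Multiset.mem_map]
  constructor
  · rintro ⟨z, hz, h⟩
    have hz' := (mem_roots_map_iff hP z).mp hz
    exact ⟨z, hz', (aeval_envG_eq_zero_iff N M x 0 z (h0 z hz')).mp h⟩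
  · rintro ⟨z, hz, h⟩
    exact ⟨z, (mem_roots_map_iff hP z).mpr hz, (aeval_envG_eq_zero_iff N M x 0 z (h0 z hz)).mpr h⟩

/-- The envelope kills `γ_k` (with `N = 2 den a_k den b_k`, `M = 2 den a_k num b_k`, `P(α) = 0`). -/
theorem aeval_envPoly_gam {ℓ : ℝ} {a b : ℕ → ℚ} {P : ℤ[X]} (hP : P ≠ 0)
    (h0 : ∀ z : ℂ, Polynomial.aeval z P = 0 → z ≠ 0) (hα : Polynomial.aeval (cexp ((ℓ : ℂ) * I)) P = 0) (k : ℕ) :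
    Polynomial.aeval (gam ℓ a b k) (envPoly P (2 * (a k).den * (b k).den) (2 * ((a k).den : ℤ) * (b k).num)) = 0 :=
  (aeval_envPoly_eq_zero_iff hP h0 _ _ _).mpr ⟨_, hα, gam_pow_eq ℓ a b k⟩

/-- The envelope is not the zero polynomial (`N ≥ 1`): at a large real `x` no factor vanishes. -/
theorem envPoly_ne_zero {P : ℤ[X]} (hP : P ≠ 0) (h0 : ∀ z : ℂ, Polynomial.aeval z P = 0 → z ≠ 0)
    {N : ℕ} (hN : 0 < N) (M : ℤ) : envPoly P N M ≠ 0 := by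
  classical
  intro hzero
  -- a real radius beating every `‖α_j^M‖`
  obtain ⟨R, hR1, hR⟩ : ∃ R : ℝ, 1 ≤ R ∧ ∀ z ∈ (P.map (Int.castRingHom ℂ)).roots, ‖z ^ M‖ < R := by
    refine ⟨1 + ((P.map (Int.castRingHom ℂ)).roots.map fun z => ‖z ^ M‖).sum, ?_, fun z hz => ?_⟩
    · have : 0 ≤ ((P.map (Int.castRingHom ℂ)).roots.map fun z => ‖z ^ M‖).sum :=
        Multiset.sum_nonneg fun x hx => by
          obtain ⟨z, _, rfl⟩ := Multiset.mem_map.mp hx; exact norm_nonneg _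
      linarith
    · have : ‖z ^ M‖ ≤ ((P.map (Int.castRingHom ℂ)).roots.map fun z => ‖z ^ M‖).sum :=
        Multiset.single_le_sum (fun x hx => by
          obtain ⟨z, _, rfl⟩ := Multiset.mem_map.mp hx; exact norm_nonneg _) _
          (Multiset.mem_map_of_mem _ hz)
      linarith
  have h := (aeval_envPoly_eq_zero_iff hP h0 N M (R : ℂ)).mp (by rw [hzero, map_zero])
  obtain ⟨z, hz, hzR⟩ := h
  have hz' : z ∈ (P.map (Int.castRingHom ℂ)).roots := (mem_roots_map_iff hP z).mpr hz
  have h1 : ‖((R : ℂ)) ^ N‖ = R ^ N := by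
    rw [norm_pow, Complex.norm_real, Real.norm_eq_abs, abs_of_pos (by linarith)]
  have h2 : R ≤ R ^ N := by
    calc R = R ^ 1 := (pow_one R).symm
      _ ≤ R ^ N := pow_le_pow_right₀ hR1 hN
  have h3 := hR z hz'
  rw [← hzR, h1] at h3
  linarith

/-- Degree of the envelope: `≤ (deg P + N + |M|)·(N + |M|)`. -/
theorem natDegree_envPoly_le (P : ℤ[X]) (N : ℕ) (M : ℤ) :
    (envPoly P N M).natDegree ≤ (P.natDegree + (N + M.natAbs)) * (N + M.natAbs) := by
  refine (natDegree_univ0_le _).trans ((resT_bounds P (envG N M)).2.trans ?_)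
  have h1 : (toPolyT (envG N M)).natDegree ≤ N + M.natAbs :=
    (natDegree_toPolyT_le _).trans (totalDegree_envG_le N M)
  have h2 := totalDegree_envG_le N M
  gcongr

/-- Every `ℚ`-conjugate of `γ_k` is a root of the envelope (it is an integer polynomial killing `γ_k`). -/
theorem aeval_envPoly_conj {P : ℤ[X]} {N : ℕ} {M : ℤ} {γ γ' : ℂ} (hc : IsConjRoot ℚ γ γ')
    (hγ : Polynomial.aeval γ (envPoly P N M) = 0) : Polynomial.aeval γ' (envPoly P N M) = 0 := by
  have h1 : Polynomial.aeval γ ((envPoly P N M).map (algebraMap ℤ ℚ)) = 0 := by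
    rw [Polynomial.aeval_map_algebraMap]; exact hγ
  have h2 : minpoly ℚ γ' ∣ (envPoly P N M).map (algebraMap ℤ ℚ) := by
    rw [show minpoly ℚ γ' = minpoly ℚ γ from hc.symm]; exact minpoly.dvd ℚ γ h1
  have h3 := Polynomial.aeval_eq_zero_of_dvd_aeval_eq_zero h2 (minpoly.aeval ℚ γ')
  rwa [Polynomial.aeval_map_algebraMap] at h3

/-- House envelope: a root `x` of the envelope has `‖x‖ ≤ A^{|M|}` whenever `A ≥ 1` bounds `‖α_j‖` and `‖α_j‖⁻¹`
for every root `α_j` of `P` (and `N ≥ 1`). -/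
theorem norm_le_of_aeval_envPoly {P : ℤ[X]} (hP : P ≠ 0) (h0 : ∀ z : ℂ, Polynomial.aeval z P = 0 → z ≠ 0)
    {A : ℝ} (hA1 : 1 ≤ A) (hA : ∀ z : ℂ, Polynomial.aeval z P = 0 → ‖z‖ ≤ A ∧ ‖z‖⁻¹ ≤ A)
    {N : ℕ} (hN : 0 < N) (M : ℤ) {x : ℂ} (hx : Polynomial.aeval x (envPoly P N M) = 0) :
    ‖x‖ ≤ A ^ M.natAbs := by
  obtain ⟨z, hz, hxz⟩ := (aeval_envPoly_eq_zero_iff hP h0 N M x).mp hx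
  have hzA := hA z hz
  have hz0 := h0 z hz
  -- ‖x‖^N = ‖z^M‖ ≤ A^{|M|}
  have h1 : ‖x‖ ^ N ≤ A ^ M.natAbs := by
    rw [← norm_pow, hxz, norm_zpow]
    rcases Int.natAbs_eq M with hM | hM
    · rw [hM, zpow_natCast, Int.natAbs_natCast]
      exact pow_le_pow_left₀ (norm_nonneg _) hzA.1 _
    · rw [hM, zpow_neg, zpow_natCast, Int.natAbs_neg, Int.natAbs_natCast, ← inv_pow]
      exact pow_le_pow_left₀ (inv_nonneg.mpr (norm_nonneg _)) hzA.2 _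
  have hAM : 1 ≤ A ^ M.natAbs := one_le_pow₀ hA1
  by_contra hlt
  push Not at hlt
  have hx1 : 1 < ‖x‖ := lt_of_le_of_lt hAM hlt
  have : ‖x‖ ≤ ‖x‖ ^ N := by
    calc ‖x‖ = ‖x‖ ^ 1 := (pow_one _).symm
      _ ≤ ‖x‖ ^ N := pow_le_pow_right₀ hx1.le hN
  linarith

/-- α-DATA: a non-zero INTEGER polynomial killing the algebraic `α ≠ 0`, with no root at `0`. -/
theorem exists_intPoly {α : ℂ} (halg : IsAlgebraic ℚ α) (hα : α ≠ 0) :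
    ∃ P : ℤ[X], P ≠ 0 ∧ Polynomial.aeval α P = 0 ∧ ∀ z : ℂ, Polynomial.aeval z P = 0 → z ≠ 0 := by
  classical
  obtain ⟨P₀, hP₀, hP₀α⟩ := (IsFractionRing.isAlgebraic_iff ℤ ℚ ℂ).mpr halg
  obtain ⟨q, hq, hndvd⟩ := Polynomial.exists_eq_pow_rootMultiplicity_mul_and_not_dvd P₀ hP₀ 0
  rw [map_zero, sub_zero] at hq hndvd
  have hq0 : q ≠ 0 := by rintro rfl; exact hndvd (dvd_zero _)
  have hqα : Polynomial.aeval α q = 0 := by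
    have h := hP₀α
    rw [hq, map_mul, map_pow, Polynomial.aeval_X] at h
    exact (mul_eq_zero.mp h).resolve_left (pow_ne_zero _ hα)
  refine ⟨q, hq0, hqα, fun z hz h0 => hndvd ?_⟩
  rw [Polynomial.X_dvd_iff]
  rw [h0, Polynomial.aeval_def, Polynomial.eval₂_at_zero, algebraMap_int_eq, eq_intCast,
    Int.cast_eq_zero] at hz
  exact hz

/-- HOUSE CONSTANT of `P`: some `A ≥ 1` bounds `‖α_j‖` and `‖α_j‖⁻¹` for every complex root `α_j`. -/
theorem exists_house_const {P : ℤ[X]} (hP : P ≠ 0) :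
    ∃ A : ℝ, 1 ≤ A ∧ ∀ z : ℂ, Polynomial.aeval z P = 0 → ‖z‖ ≤ A ∧ ‖z‖⁻¹ ≤ A := by
  classical
  have hnn : ∀ x ∈ (P.map (Int.castRingHom ℂ)).roots.map (fun z => ‖z‖ + ‖z‖⁻¹), (0 : ℝ) ≤ x :=
    fun x hx => by
      obtain ⟨z, _, rfl⟩ := Multiset.mem_map.mp hx
      exact add_nonneg (norm_nonneg _) (inv_nonneg.mpr (norm_nonneg _))
  refine ⟨1 + ((P.map (Int.castRingHom ℂ)).roots.map fun z => ‖z‖ + ‖z‖⁻¹).sum, ?_, fun z hz => ?_⟩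
  · linarith [Multiset.sum_nonneg hnn]
  · have hmem := (mem_roots_map_iff hP z).mpr hz
    have hle : ‖z‖ + ‖z‖⁻¹ ≤ ((P.map (Int.castRingHom ℂ)).roots.map fun z => ‖z‖ + ‖z‖⁻¹).sum :=
      Multiset.single_le_sum hnn _ (Multiset.mem_map_of_mem _ hmem)
    constructor <;> linarith [norm_nonneg z, inv_nonneg.mpr (norm_nonneg z)]

/-- `lc(P)·α_j` and `tc(P)·α_j⁻¹` are algebraic integers for every root `α_j ≠ 0` of `P ∈ ℤ[X]`. -/
theorem isIntegral_lc_mul {P : ℤ[X]} {z : ℂ} (hz : Polynomial.aeval z P = 0) :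
    IsIntegral ℤ ((P.leadingCoeff : ℂ) * z) := by
  have h := isIntegral_leadingCoeff_smul (R := ℤ) (p := P) (x := z) hz
  rwa [Algebra.smul_def, algebraMap_int_eq, eq_intCast] at h

/-- `tc(P) · z⁻¹` is an algebraic integer for a non-zero root `z` of `P ∈ ℤ[T]`. -/
theorem isIntegral_tc_mul_inv {P : ℤ[X]} {z : ℂ} (hz : Polynomial.aeval z P = 0) (hz0 : z ≠ 0) :
    IsIntegral ℤ ((P.trailingCoeff : ℂ) * z⁻¹) := by
  haveI : Invertible z := invertibleOfNonzero hz0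
  have hrev : Polynomial.aeval z⁻¹ P.reverse = 0 := by
    rw [Polynomial.aeval_def, show z⁻¹ = ⅟z from (invOf_eq_inv z).symm,
      Polynomial.eval₂_reverse_eq_zero_iff, ← Polynomial.aeval_def]
    exact hz
  have h := isIntegral_leadingCoeff_smul (R := ℤ) (p := P.reverse) (x := z⁻¹) hrev
  rwa [Polynomial.reverse_leadingCoeff, Algebra.smul_def, algebraMap_int_eq, eq_intCast] at h

/-- Integers are algebraic integers in `ℂ`. -/
private theorem isIntegral_intCast' (n : ℤ) : IsIntegral ℤ (n : ℂ) := by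
  have h := isIntegral_algebraMap (R := ℤ) (A := ℂ) (x := n)
  rwa [algebraMap_int_eq, eq_intCast] at h

/-- DENOMINATOR: `(lc P · tc P)^{|M|} · x` is an algebraic integer for every root `x` of the envelope
(`x^N = α_j^M`, `N ≥ 1`). -/
theorem isIntegral_denom_mul {P : ℤ[X]} (hP : P ≠ 0) (h0 : ∀ z : ℂ, Polynomial.aeval z P = 0 → z ≠ 0)
    {N : ℕ} (hN : 0 < N) (M : ℤ) {x : ℂ} (hx : Polynomial.aeval x (envPoly P N M) = 0) :
    IsIntegral ℤ ((((P.leadingCoeff * P.trailingCoeff) ^ M.natAbs : ℤ) : ℂ) * x) := by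
  obtain ⟨z, hz, hxz⟩ := (aeval_envPoly_eq_zero_iff hP h0 N M x).mp hx
  have hz0 := h0 z hz
  have hcz := isIntegral_lc_mul hz
  have hc0z := isIntegral_tc_mul_inv hz hz0
  obtain ⟨N', rfl⟩ : ∃ N', N = N' + 1 := ⟨N - 1, by omega⟩
  apply IsIntegral.of_pow hN
  rw [mul_pow, hxz]
  push_cast
  set c : ℂ := (P.leadingCoeff : ℂ)
  set c₀ : ℂ := (P.trailingCoeff : ℂ)
  have hc : IsIntegral ℤ c := isIntegral_intCast' _
  have hc₀ : IsIntegral ℤ c₀ := isIntegral_intCast' _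
  rcases Int.natAbs_eq M with hM | hM
  · -- `M = m ≥ 0`: `((c c₀)^m)^(N'+1) z^m = (c^m)^N' · (c₀^m)^(N'+1) · (c z)^m`
    rw [hM, zpow_natCast, Int.natAbs_natCast]
    have : ((c * c₀) ^ M.natAbs) ^ (N' + 1) * z ^ M.natAbs =
        (c ^ M.natAbs) ^ N' * (c₀ ^ M.natAbs) ^ (N' + 1) * (c * z) ^ M.natAbs := by ring
    rw [this]
    exact ((hc.pow _).pow _).mul ((hc₀.pow _).pow _) |>.mul (hcz.pow _)
  · -- `M = -m < 0`: `((c c₀)^m)^(N'+1) (z⁻¹)^m = (c^m)^(N'+1) · (c₀^m)^N' · (c₀ z⁻¹)^m`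
    rw [hM, zpow_neg, zpow_natCast, Int.natAbs_neg, Int.natAbs_natCast, ← inv_pow]
    have : ((c * c₀) ^ M.natAbs) ^ (N' + 1) * z⁻¹ ^ M.natAbs =
        (c ^ M.natAbs) ^ (N' + 1) * (c₀ ^ M.natAbs) ^ N' * (c₀ * z⁻¹) ^ M.natAbs := by ring
    rw [this]
    exact ((hc.pow _).pow _).mul ((hc₀.pow _).pow _) |>.mul (hc0z.pow _)

end ConjDataDev

end Bilog
end LatCell
end HyperCell
end Summit.Schanuel.Schanuel.Theorems.RootDecomp1KHyper
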